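import Mathlib
import Summits.Ventures.PercRepro2.HCov
import Summits.Ventures.PercRepro2.OneEdge
import Summits.Ventures.PercRepro2.CCTRootEdge
import Summits.Ventures.PercRepro2.A3RootEdge
import Summits.Ventures.PercRepro2.HCovPlusQuartic

/-!
# THE CROSS TERM OF THE QUARTIC'S ROOT-EDGE FACE, DECOMPOSED (blind cell PercRepro2, p5 g17;
`proofs/P5-OEDGE.md` §23)

At a root edge `e = {a₁, a₃}` the two open coefficients of the quartic (`HCovPlusQuartic.H1_eq_root`,
`H2_eq_root`) carry the cross term `c = covUm = Qo₁·D₀ − Q₁·Do₀` (`covUm_eq_root`). Gluing the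
open pin onto the closed one (`OneEdge.conn_update_true_iff`, `RootEdge.update_true_mem_Q_iff`):
`Q₁ = P₀(PD) + P₀(T′)` (**`prob_one_Q_root_split`**) and
`Qo₁ = Do₀ + P₀(PD, o ↔ a₃) + P₀(T′, o ∈ U)` (**`Qo_one_root_split`**), hence
**`covUm_root_decomp`**: `c = D₀·P₀(PD, o ↔ a₃) + [D₀·P₀(T′, o ∈ U) − Do₀·P₀(T′)]` — a nonnegative
term (`o` in the cluster of the isolated `a₃`) plus the difference `P(o ∈ U | T′) − P(o ∈ U | PD)`
scaled by `D₀·P₀(T′)`; the negative part of `c` is exactly the BHK-type anti-correlation of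
`{a₃ ∈ C₁}` and `{o ∈ C₂}` (the `oH` half of the bracket, `≤ 0` by `A3Inactive.T'oH_mul_D_le`),
against the `oL` half and the first term. Checked exactly on 300 random instances before typing
(mining/p5/g17/litjob/cprobe.py); `c < 0` on 7 / 12,600 root-edge lines of the census (§22).
-/

namespace Summit.Ventures.PercRepro2

open UnionCluster CovForm CovForm.CPolarA3 CovForm.RootEdge CCT HCovPlusQuartic

namespace QuarticRootCross

section Split

variable {V : Type*} {E : Type*} [Fintype V] [DecidableEq V] [Fintype E] [DecidableEq E]
  {R : Type*} [Field R] [LinearOrder R] [IsStrictOrderedRing R]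

variable {ends : E → Sym2 V} {e : E} {a₁ a₃ : V}

omit [Fintype V] [DecidableEq V] [Fintype E] [LinearOrder R] [IsStrictOrderedRing R] in
/-- With `e = {a₁, a₃}`, `a₁ ↔ x` in `ω[e↦open]` iff `a₁ ↔ x` or `a₃ ↔ x` in `ω[e↦closed]`. -/
lemma conn_a1_update_true_iff (hends : ends e = s(a₁, a₃)) (ω : Config E) (x : V) :
    Conn ends (Function.update ω e true) a₁ x ↔
      Conn ends (Function.update ω e false) a₁ x ∨ Conn ends (Function.update ω e false) a₃ x := by
  have h := OneEdge.conn_update_true_iff hends (Function.update ω e false) a₁ x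
  rw [Function.update_idem] at h
  rw [h]
  constructor
  · rintro (h1 | ⟨_, h3⟩ | ⟨_, h1⟩)
    · exact Or.inl h1
    · exact Or.inr h3
    · exact Or.inl h1
  · rintro (h1 | h3)
    · exact Or.inl h1
    · exact Or.inr (Or.inl ⟨conn_refl ends _ a₁, h3⟩)

omit [Fintype V] [LinearOrder R] [IsStrictOrderedRing R] in
/-- `Q ∩ {a₃ ∉ C₂} ∩ Y` splits as `PD ∩ Y` plus `T′ ∩ Y` (the world `T` is excluded). -/
lemma prob_Q_not_a3_C2_split (q : E → R) (a₂ : V) (Y : Set (Config E)) :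
    prob q (avoidAll ends a₂ {a₁} ∩ ((connEvent ends a₂ a₃)ᶜ ∩ Y)) =
      prob q (PDEvent ends a₁ a₂ a₃ ∩ Y) + prob q (TEvent ends a₂ a₁ a₃ ∩ Y) := by
  rw [Qsplit q ends a₁ a₂ a₃ ((connEvent ends a₂ a₃)ᶜ ∩ Y)]
  have hT : TEvent ends a₁ a₂ a₃ ∩ ((connEvent ends a₂ a₃)ᶜ ∩ Y) = ∅ := by
    ext ω
    simp only [TEvent, Set.mem_inter_iff, Set.mem_compl_iff, mem_connEvent, Set.mem_empty_iff_false,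
      iff_false, not_and]
    intro hT h23 _
    exact h23 hT.2
  have hPD : PDEvent ends a₁ a₂ a₃ ∩ ((connEvent ends a₂ a₃)ᶜ ∩ Y) = PDEvent ends a₁ a₂ a₃ ∩ Y := by
    ext ω
    simp only [PDEvent, Dtilde, Set.mem_inter_iff, Set.mem_compl_iff, mem_inU, mem_connEvent]
    constructor
    · rintro ⟨h, _, hY⟩; exact ⟨h, hY⟩
    · rintro ⟨⟨h12, h3⟩, hY⟩
      exact ⟨⟨h12, h3⟩, fun h23 => h3 (Or.inr (conn_symm h23)), hY⟩
  have hT' : TEvent ends a₂ a₁ a₃ ∩ ((connEvent ends a₂ a₃)ᶜ ∩ Y) = TEvent ends a₂ a₁ a₃ ∩ Y := by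
    ext ω
    simp only [TEvent, Set.mem_inter_iff, Set.mem_compl_iff, mem_connEvent]
    constructor
    · rintro ⟨h, _, hY⟩; exact ⟨h, hY⟩
    · rintro ⟨⟨h12, h13⟩, hY⟩
      exact ⟨⟨h12, h13⟩, fun h23 => h12 (conn_trans h13 (conn_symm h23)), hY⟩
  rw [hT, prob_empty, hPD, hT']
  ring

omit [Fintype V] [LinearOrder R] [IsStrictOrderedRing R] in
/-- **`Q₁ = P₀(PD) + P₀(T′)`** at a root edge. -/
theorem prob_one_Q_root_split (p : E → R) (hends : ends e = s(a₁, a₃)) (a₂ : V) :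
    prob (Function.update p e 1) (avoidAll ends a₂ {a₁}) =
      prob (Function.update p e 0) (PDEvent ends a₁ a₂ a₃) +
        prob (Function.update p e 0) (TEvent ends a₂ a₁ a₃) := by
  rw [prob_one_Q p hends a₂]
  have := prob_Q_not_a3_C2_split (ends := ends) (a₁ := a₁) (a₃ := a₃) (Function.update p e 0) a₂
    Set.univ
  simpa only [Set.inter_univ] using this

omit [Fintype V] [DecidableEq V] [LinearOrder R] [IsStrictOrderedRing R] in
/-- `P₁(Q ∩ {a₁ ↔ x}) = P₀(Q ∩ {a₃ ∉ C₂} ∩ ({a₁ ↔ x} ∪ {a₃ ↔ x}))` at a root edge. -/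
lemma prob_one_Q_conn_a1 (p : E → R) (hends : ends e = s(a₁, a₃)) (a₂ x : V) :
    prob (Function.update p e 1) (avoidAll ends a₂ {a₁} ∩ connEvent ends a₁ x) =
      prob (Function.update p e 0)
        (avoidAll ends a₂ {a₁} ∩ ((connEvent ends a₂ a₃)ᶜ ∩ (connEvent ends a₁ x ∪ connEvent ends a₃ x))) := by
  rw [prob_update_one_eq, prob_update_zero_eq]
  congr 1
  ext ω
  simp only [Set.mem_setOf_eq, Set.mem_inter_iff, Set.mem_union, Set.mem_compl_iff, mem_connEvent,
    update_true_mem_Q_iff hends a₂ ω, conn_a1_update_true_iff hends ω x]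
  tauto

omit [Fintype V] [DecidableEq V] [LinearOrder R] [IsStrictOrderedRing R] in
/-- On `PD`, `{a₁ ↔ x}` and `{a₃ ↔ x}` are disjoint; on `T′`, `{a₃ ↔ x}` is contained in `{a₁ ↔ x}`. -/
lemma prob_split_conn_a1_a3 (q : E → R) (a₂ x : V) :
    prob q (PDEvent ends a₁ a₂ a₃ ∩ (connEvent ends a₁ x ∪ connEvent ends a₃ x)) +
        prob q (TEvent ends a₂ a₁ a₃ ∩ (connEvent ends a₁ x ∪ connEvent ends a₃ x)) =
      prob q (PDEvent ends a₁ a₂ a₃ ∩ connEvent ends a₁ x) +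
        prob q (PDEvent ends a₁ a₂ a₃ ∩ connEvent ends a₃ x) +
        prob q (TEvent ends a₂ a₁ a₃ ∩ connEvent ends a₁ x) := by
  have hPD : prob q (PDEvent ends a₁ a₂ a₃ ∩ (connEvent ends a₁ x ∪ connEvent ends a₃ x)) =
      prob q (PDEvent ends a₁ a₂ a₃ ∩ connEvent ends a₁ x) +
        prob q (PDEvent ends a₁ a₂ a₃ ∩ connEvent ends a₃ x) := by
    rw [Set.inter_union_distrib_left]
    rw [prob_union_of_disjoint]
    rw [Set.disjoint_left]
    intro ω ⟨hPD, h1x⟩ ⟨_, h3x⟩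
    simp only [PDEvent, Dtilde, Set.mem_inter_iff, Set.mem_compl_iff, mem_inU, mem_connEvent] at hPD
    exact hPD.2 (Or.inl (conn_trans h3x (conn_symm h1x)))
  have hT' : TEvent ends a₂ a₁ a₃ ∩ (connEvent ends a₁ x ∪ connEvent ends a₃ x) =
      TEvent ends a₂ a₁ a₃ ∩ connEvent ends a₁ x := by
    ext ω
    simp only [TEvent, Set.mem_inter_iff, Set.mem_union, Set.mem_compl_iff, mem_connEvent]
    constructor
    · rintro ⟨⟨h12, h13⟩, h1x | h3x⟩
      · exact ⟨⟨h12, h13⟩, h1x⟩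
      · exact ⟨⟨h12, h13⟩, conn_trans h13 h3x⟩
    · rintro ⟨h, h1x⟩; exact ⟨h, Or.inl h1x⟩
  rw [hPD, hT']

omit [Fintype V] [LinearOrder R] [IsStrictOrderedRing R] in
/-- **`Qo₁ = Do₀ + P₀(PD, o ↔ a₃) + P₀(T′, o ∈ U)`** at a root edge. -/
theorem Qo_one_root_split (p : E → R) (hends : ends e = s(a₁, a₃)) (o a₂ : V) :
    Qo (Function.update p e 1) ends o a₁ a₂ =
      Do (Function.update p e 0) ends o a₁ a₂ a₃ +
        prob (Function.update p e 0) (PDEvent ends a₁ a₂ a₃ ∩ connEvent ends a₃ o) +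
        (prob (Function.update p e 0) (TEvent ends a₂ a₁ a₃ ∩ connEvent ends a₁ o) +
          prob (Function.update p e 0) (TEvent ends a₂ a₁ a₃ ∩ connEvent ends a₂ o)) := by
  unfold Qo Do
  rw [prob_one_Q_conn_a1 p hends a₂ o, prob_one_Q_conn p hends a₂ o]
  rw [prob_Q_not_a3_C2_split (Function.update p e 0) a₂]
  have h2 : prob (Function.update p e 0) (avoidAll ends a₂ {a₁} ∩ connEvent ends a₂ o ∩
      (connEvent ends a₂ a₃)ᶜ) =
      prob (Function.update p e 0) (avoidAll ends a₂ {a₁} ∩ ((connEvent ends a₂ a₃)ᶜ ∩ connEvent ends a₂ o)) := by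
    congr 1; ext ω; simp only [Set.mem_inter_iff]; tauto
  rw [h2, prob_Q_not_a3_C2_split (Function.update p e 0) a₂, prob_split_conn_a1_a3]
  ring

omit [Fintype V] [LinearOrder R] [IsStrictOrderedRing R] in
/-- **The cross term of the quartic's root-edge face, decomposed**:
`c = D₀·P₀(PD, o ↔ a₃) + [D₀·P₀(T′, o ∈ U) − Do₀·P₀(T′)]`. -/
theorem covUm_root_decomp (p : E → R) (hends : ends e = s(a₁, a₃)) (o a₂ : V) :
    covUm p ends o a₁ a₂ a₃ e =
      prob (Function.update p e 0) (PDEvent ends a₁ a₂ a₃) *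
          prob (Function.update p e 0) (PDEvent ends a₁ a₂ a₃ ∩ connEvent ends a₃ o) +
        (prob (Function.update p e 0) (PDEvent ends a₁ a₂ a₃) *
            (prob (Function.update p e 0) (TEvent ends a₂ a₁ a₃ ∩ connEvent ends a₁ o) +
              prob (Function.update p e 0) (TEvent ends a₂ a₁ a₃ ∩ connEvent ends a₂ o)) -
          Do (Function.update p e 0) ends o a₁ a₂ a₃ *
            prob (Function.update p e 0) (TEvent ends a₂ a₁ a₃)) := by
  rw [covUm_eq_root p hends o a₂, Qo_one_root_split p hends o a₂, prob_one_Q_root_split p hends a₂]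
  ring

end Split

end QuarticRootCross

end Summit.Ventures.PercRepro2
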